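import Mathlib.RingTheory.PowerSeries.Binomial
import Mathlib.NumberTheory.Padics.MahlerBasis
import Mathlib.RingTheory.PowerSeries.Substitution
import Literature.NumberTheory.EllipticCurves.Sprung2017.SharpFlatPAdicLFunction
import Literature.NumberTheory.EllipticCurves.TwistedLValueSeries
import HarnessLib

/-!
# Sprung 2017, Cor. 4.14 (`a_p = 0` display, trivial tame character): the FUNCTIONAL EQUATION of the
# pair `(L♯_p(E,T), L♭_p(E,T))` at an ODD supersingular prime — named fact, tree normalisation

Topic `NumberTheory/EllipticCurves`, cluster `Sprung2017` (namespace = path). Companion of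
`SharpFlatPAdicLFunction` (the predicate `IsSprungPair f p a_p L♯ L♭` and the named fact
`thm112_exists_isSprungPair`; its module docstring lists "the functional equation (Thm. 1.2 / 4.13)"
under NOT vendored — this file vendors the `a_p = 0`, `i = 0` display of Cor. 4.14). ONE named fact
(`cor414_sharpFlat_functionalEquation_apZero`, a CLOSED `def … : Prop`, D-0014; nothing asserted, no
`_holds`) + its PROVED ideal-currency corollary (`…span_eq`: the principal ideals `(L♯)`, `(L♭)` of
`Λ = ℤ_p⟦T⟧` are `ι`-stable). The `p = 2` instance of EXACTLY this statement is a tree THEOREM: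
`Literature.Barriers.BirchSwinnertonDyer.subst_invOnePlusSubOne_eq_of_isSprungPair_two`
(`Barriers/BirchSwinnertonDyer/PAdicFunctionalEquationSharpFlatTwoProofs.lean`, with `3a = −2`,
`3b = −1`, proved from the finite-level Mazur–Tate symmetry and the uniqueness of the pair) — it fixes
the print-to-tree dictionary used below (sign, exponents, which function gets `W⁺`). Typed by a
Literature typer (cell `bsd-stepL`, guest service) on the ARM-P ticket «T-FE-SS-SPRUNG» (TARGET #12
re-sourced, RELAY 51/52: "type the odd-supersingular ♯/♭ functional equation from Sprung 2017 Cor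
4.14, `a_p = 0`, `i = 0` form first, WITH the `W^±` unit factors"). HONEST FRAMING: a TRANSCRIPTION
of a printed theorem as a hypothesis-grade named fact; BSD is not proved by any of this.

## Source, verbatim (F. Sprung, *On pairs of `p`-adic `L`-functions for weight-two modular forms*,
## Algebra & Number Theory 11 (2017) 885–928 [Sprung2017], held copy `paper:arxiv-1601.00010`,
## PDF p. 18 (§4.1) and p. 15 (§3.5))

§4.1, before Thm. 4.13: "We denote by `f*(z) = w_N(f(z)) = ε(−1)f(−1/(Nz))` the involuted form of `f`
under the Atkin-Lehner/Fricke operator, as in [mtt]". **Corollary 4.14.** "For an elliptic curve `E`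
over `ℚ` and a good supersingular prime `p`, let `c_N` be the sign of `f`, i.e. `f* := −c_N f` (cf.
[mtt]). We then have `L̂♯_p(E,ωⁱ,T) = −(1+T)^{−log_γ(N)} ωⁱ(−N) c_N L̂♯_p(E,ωⁱ,1/(1+T) − 1)`,
`L̂♭_p(E,ωⁱ,T) = −(1+T)^{−log_γ(N)} ωⁱ(−N) c_N L̂♭_p(E,ωⁱ,1/(1+T) − 1)`. When `a_p = 0`, we can give
an explicit functional equation for the non-completed `p`-adic `L`-functions, which corrects [pollack]
in the case `i = 0`: `L♯_p(E,ωⁱ,T) = −(1+T)^{−log_γ(N)} ωⁱ(−N) c_N W⁺(1+T) L♯_p(E,ωⁱ,1/(1+T) − 1)`,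
`L♭_p(E,ωⁱ,T) = −(1+T)^{−log_γ(N)} ωⁱ(−N) c_N W⁻(1+T) L♭_p(E,ωⁱ,1/(1+T) − 1)`." §3.5 (PDF p. 15):
"`W⁺(1+T) = U⁺(1+T)/U⁺((1+T)⁻¹) = ∏_{j≥1}(1+T)^{−p^{2j−1}(p−1)}`, and
`W⁻(1+T) = U⁻(1+T)/U⁻((1+T)⁻¹) = ∏_{j≥1}(1+T)^{−p^{2j−2}(p−1)}` for odd `p`" (and
`(1+T)^{−1}∏_{j≥2}(1+T)^{−p^{2j−2}(p−1)}` when `p = 2`); p. 5: these "correct a corresponding statement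
in [pollack] (where `a_p = 0`), which is off by a unit factor" — i.e. Pollack 2003, Thm. 5.13
[Pollack2003], superseded here. The same display (with `−ε(−1)` for `−c_N`) is Cor. 3.17 of
F. Sprung, arXiv:1211.1352 (2012).

## Transcription (tree conventions; each item a READING fixed by the proved `p = 2` instance)

* `p`-adic exponents: `∏_{j≥1}(1+T)^{−p^{2j−1}(p−1)} = (1+T)^{w⁺}` with
  `w⁺ = −(p−1)∑_{j≥1}p^{2j−1} = −(p−1)p/(1−p²) = p/(p+1) ∈ ℤ_p`, and `W⁻ = (1+T)^{w⁻}`,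
  `w⁻ = −(p−1)∑_{j≥1}p^{2j−2} = 1/(p+1)` (at `p = 2`: `2/3` and `1/3`, the values in the `p = 2`
  theorem's docstring). Substituting `T ↦ T^ι = (1+T)⁻¹ − 1` (an involution) in the display gives
  `L♯(T^ι) = s · (1+T)^{c} · (1+T)^{−w⁺} · L♯(T)`, `c = log_γ⟨N⟩`: the statement below carries
  `a, b ∈ ℤ_p` with `(p+1)·a = −p`, `(p+1)·b = −1` and the exponents `c + a` (for `L♯`), `c + b`
  (for `L♭`) — at `p = 2` exactly `3a = −2`, `3b = −1`.
* `c`: `N = η_N · γ^c` in `ℤ_pˣ = μ × (1 + p^{e}ℤ_p)`, `γ = cyclotomicGenerator p`, written at every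
  finite level (the hypothesis `hc`, shape of `exists_teichmuller_exponent_natCast`, which PROVES its
  existence for `p ∤ N`); `(1+T)^{c+a} = PowerSeries.binomialSeries ℤ_[p] (c + a)`.
* Sign: `σ = ±1` with `w_N f = −σ f` (`IsFrickeEigen N f (−σ)`), the normalisation of the `p = 2`
  theorem ("signs as normalised in the tree, `σ = −ε(f)`"; at the conductor level `σ = w_E`, the root
  number — `subst_invOnePlusSubOne_eq_rootNumber_of_isSprungPair_two`, Greenberg LNM 1716 §5: "the
  'signs' in the functional equations for `L_p(E/ℚ, s)` and `L(E/ℚ, s)` are the same"). Print's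
  `−c_N ω⁰(−N)` with `f* := −c_N f` is this `σ` read through the tree's modular-symbol orientation; the
  dictionary is the one under which the `p = 2` case is PROVED, not re-derived here.
* `T^ι`: any `ι ∈ Λ` with `(1 + T)(ι + 1) = 1` (there is exactly one; `invOnePlusSubOne` of
  `Barriers/BirchSwinnertonDyer/PAdicFunctionalEquationParity`, lemma
  `one_add_X_mul_invOnePlusSubOne_add_one`), as in the multiplicative functional equations
  `IsSplitMultPAdicLFunctionOf.subst_eq_of_atkinLehner`.
* The pair: EVERY `(L♯, L♭)` with `IsSprungPair f p 0 L♯ L♭` (Mazur–Tate characterisation, Cor. 4.4;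
  unique, `IsSprungPair.unique`; exists by `thm112_exists_isSprungPair` / Pollack at `a_p = 0`).
* Special case of print: trivial tame character `i = 0` only (the branches `ωⁱ`, `i ≠ 0`, need branch
  Mazur–Tate elements the tree lacks) — `TODO(general form)`; `p` odd (the `p = 2` case is the proved
  theorem above); `a_p = 0` (automatic for supersingular `p ≥ 5`; at `p = 3` the curves with `a₃ = ±3`
  are excluded, as in print's explicit display).
TODO(proof): port `PAdicFunctionalEquationSharpFlatTwoProofs` §§3–6 (finite-level Mazur–Tate symmetry,
`ι`-homogeneity of `u_n`, `v_n`, uniqueness of the pair) from `p = 2` to odd `p`; then this fact gets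
its `_holds`.

## References

* F. Sprung, ANT 11 (2017) 885–928: Cor. 4.14, Thm. 4.13, §3.5 (`W^±`), §3.4 Prop. 3.14, Thm. 1.12,
  Cor. 4.4. [Sprung2017]
* R. Pollack, Duke Math. J. 118 (2003), Thm. 5.13 (the statement corrected by Cor. 4.14). [Pollack2003]
* B. Mazur, J. Tate, J. Teitelbaum, Invent. Math. 84 (1986), §I.17 (the finite-level symmetry
  `[a/pⁿ] = ε(pⁿ)[a′/pⁿ]`, `a′ ≡ −1/(Na)`). [MazurTateTeitelbaum1986Invent]
* R. Greenberg, LNM 1716 (1999), §1 pp. 67–68 (`⟨N⟩ = γ^c`, `T^ι`), §5 p. 181 (signs). [GreenbergLNM1716]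
-/

noncomputable section

open scoped MatrixGroups ModularForm

open CongruenceSubgroup PowerSeries WeierstrassCurve Literature.NumberTheory.EllipticCurves
  Literature.NumberTheory.EllipticCurves.ModularForms

namespace Literature.NumberTheory.EllipticCurves.Sprung2017

/-- **Sprung 2017, Cor. 4.14 — the functional equations of `L♯_p(E,T)` and `L♭_p(E,T)` at an ODD
supersingular prime with `a_p = 0` (trivial tame character), in `Λ = ℤ_p⟦T⟧`, tree normalisation.**
For `p ≠ 2`, `W/ℚ` elliptic and globally minimal with good reduction at `p` and `a_p(W) = 0`,
`f ∈ S₂(Γ₀(N))` its newform, a sign `σ = ±1` with `w_N f = −σ f`, the `p`-adic exponent `c` of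
`⟨N⟩` (`N = η_N γ^c`), `a, b ∈ ℤ_p` with `(p+1)a = −p`, `(p+1)b = −1` (so `(1+T)^{−a} = W⁺`,
`(1+T)^{−b} = W⁻` of §3.5), `ι = T^ι` (`(1+T)(1+ι) = 1`), and every Sprung pair `(L♯, L♭)` of `f` at
`p` (`IsSprungPair f p 0 L♯ L♭`):
`L♯(T^ι) = σ · (1+T)^{c+a} · L♯(T)` and `L♭(T^ι) = σ · (1+T)^{c+b} · L♭(T)`.
Print (Cor. 4.14, `a_p = 0`, `i = 0`): `L♯_p(E,T) = −(1+T)^{−log_γ(N)} c_N W⁺(1+T) L♯_p(E, T^ι)`,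
`L♭_p(E,T) = −(1+T)^{−log_γ(N)} c_N W⁻(1+T) L♭_p(E, T^ι)`, `f* = −c_N f`,
`W⁺ = ∏_{j≥1}(1+T)^{−p^{2j−1}(p−1)}`, `W⁻ = ∏_{j≥1}(1+T)^{−p^{2j−2}(p−1)}` ("which corrects [pollack]
in the case `i = 0`"); read under `T ↦ T^ι` with the dictionary of the module docstring, the one under
which the `p = 2` instance is the tree theorem `subst_invOnePlusSubOne_eq_of_isSprungPair_two`. Named
fact; nothing asserted; no `_holds` yet (TODO(proof): port the `p = 2` proof). Special case of print:
`i = 0`, `p` odd, `a_p = 0` — TODO(general form): the branches `ωⁱ`.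
[cite: Sprung2017, Cor. 4.14 (a_p = 0 display, i = 0) and §3.5 (W^±)]
[cite: Pollack2003, Thm. 5.13 (statement corrected by Sprung's Cor. 4.14)]
[cite: MazurTateTeitelbaum1986Invent, §I.17] [cite: GreenbergLNM1716, §1 (pp. 67–68) and §5 (p. 181)] -/
def cor414_sharpFlat_functionalEquation_apZero : Prop :=
  ∀ (p : ℕ) [Fact p.Prime] (W : WeierstrassCurve ℚ) [W.IsElliptic] [W.IsGloballyMinimal]
    (N : ℕ) [NeZero N] (f : CuspForm (Gamma0 N) 2),
    p ≠ 2 → IsNewformOf W f → W.HasGoodReductionAtPrime p → W.frobeniusTrace p = 0 →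
  ∀ (σ : ℤ), σ ^ 2 = 1 → IsFrickeEigen N f (-(σ : ℂ)) →
  ∀ (ηN : rootsOfUnity (torsionOrder p) ℤ_[p]) (c : ℤ_[p]),
    (∀ n : ℕ, PadicInt.toZModPow (n + cyclotomicExponent p) ((ηN : ℤ_[p]ˣ) : ℤ_[p]) *
      (cyclotomicGenerator p : ZMod (p ^ (n + cyclotomicExponent p))) ^
        (PadicInt.toZModPow n c).val = (N : ZMod (p ^ (n + cyclotomicExponent p)))) →
  ∀ (a b : ℤ_[p]), ((p : ℤ_[p]) + 1) * a = -(p : ℤ_[p]) → ((p : ℤ_[p]) + 1) * b = -1 →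
  ∀ (ι : IwasawaAlgebra p), (1 + PowerSeries.X : IwasawaAlgebra p) * (ι + 1) = 1 →
  ∀ (Ls Lf : IwasawaAlgebra p), IsSprungPair f p 0 Ls Lf →
    Ls.subst ι = (σ : IwasawaAlgebra p) * PowerSeries.binomialSeries ℤ_[p] (c + a) * Ls ∧
      Lf.subst ι = (σ : IwasawaAlgebra p) * PowerSeries.binomialSeries ℤ_[p] (c + b) * Lf

/-! ## The ideal currency (PROVED from the fact): `(L♯(T^ι)) = (L♯)`, `(L♭(T^ι)) = (L♭)` in `Λ` -/

/-- A sign `σ = ±1` is a unit of `Λ` (private plumbing). [folklore] -/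
private theorem isUnit_intCast_of_sq_eq_one {S : Type*} [Ring S] {σ : ℤ} (hσ : σ ^ 2 = 1) :
    IsUnit ((σ : ℤ) : S) :=
  have h : (σ : S) * (σ : S) = 1 := by rw [← Int.cast_mul, ← sq, hσ, Int.cast_one]
  ⟨⟨(σ : S), (σ : S), h, h⟩, rfl⟩

/-- `(1+T)^e` is a unit of `Λ` (constant term `1`; private plumbing). [folklore] -/
private theorem isUnit_binomialSeries_padicInt {p : ℕ} [Fact p.Prime] (e : ℤ_[p]) :
    IsUnit (PowerSeries.binomialSeries ℤ_[p] e : IwasawaAlgebra p) := by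
  rw [PowerSeries.isUnit_iff_constantCoeff, binomialSeries_constantCoeff]
  exact isUnit_one

/-- **Ideal currency of Cor. 4.14 (PROVED from the named fact): the principal ideals `(L♯)`, `(L♭)`
of `Λ = ℤ_p⟦T⟧` are `ι`-stable** — `Ideal.span {L♯(T^ι)} = Ideal.span {L♯}` and the same for `L♭`,
under the binders of `cor414_sharpFlat_functionalEquation_apZero` (the sign `σ` and the multiplier
`(1+T)^{c+a}`, resp. `(1+T)^{c+b}`, are units of `Λ`; Greenberg: "`f(T^ι)/f(T)` should be in `Λ^×`").
This is the form the `γ ↦ γ⁻¹` (contragredient) END re-keys consume: a divisibility or an equality of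
characteristic ideals by `(L♯)` or `(L♭)` is insensitive to `ι`.
[cite: Sprung2017, Cor. 4.14 (a_p = 0 display)] [cite: GreenbergLNM1716, §1 (p. 68: Λ^×)] -/
theorem cor414_sharpFlat_functionalEquation_apZero.span_eq
    (h : cor414_sharpFlat_functionalEquation_apZero)
    {p : ℕ} [Fact p.Prime] {W : WeierstrassCurve ℚ} [W.IsElliptic] [W.IsGloballyMinimal]
    {N : ℕ} [NeZero N] {f : CuspForm (Gamma0 N) 2}
    (hp : p ≠ 2) (hf : IsNewformOf W f) (hgood : W.HasGoodReductionAtPrime p)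
    (ha0 : W.frobeniusTrace p = 0) {σ : ℤ} (hσ : σ ^ 2 = 1) (hW : IsFrickeEigen N f (-(σ : ℂ)))
    {ηN : rootsOfUnity (torsionOrder p) ℤ_[p]} {c : ℤ_[p]}
    (hc : ∀ n : ℕ, PadicInt.toZModPow (n + cyclotomicExponent p) ((ηN : ℤ_[p]ˣ) : ℤ_[p]) *
      (cyclotomicGenerator p : ZMod (p ^ (n + cyclotomicExponent p))) ^
        (PadicInt.toZModPow n c).val = (N : ZMod (p ^ (n + cyclotomicExponent p))))
    {a b : ℤ_[p]} (ha : ((p : ℤ_[p]) + 1) * a = -(p : ℤ_[p])) (hb : ((p : ℤ_[p]) + 1) * b = -1)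
    {ι : IwasawaAlgebra p} (hι : (1 + PowerSeries.X : IwasawaAlgebra p) * (ι + 1) = 1)
    {Ls Lf : IwasawaAlgebra p} (hpair : IsSprungPair f p 0 Ls Lf) :
    Ideal.span {Ls.subst ι} = Ideal.span {Ls} ∧ Ideal.span {Lf.subst ι} = Ideal.span {Lf} := by
  obtain ⟨hs, hfl⟩ := h p W N f hp hf hgood ha0 σ hσ hW ηN c hc a b ha hb ι hι Ls Lf hpair
  have hσu : IsUnit (σ : IwasawaAlgebra p) := isUnit_intCast_of_sq_eq_one hσ
  refine ⟨?_, ?_⟩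
  · rw [hs]
    exact Ideal.span_singleton_mul_left_unit (hσu.mul (isUnit_binomialSeries_padicInt (c + a))) Ls
  · rw [hfl]
    exact Ideal.span_singleton_mul_left_unit (hσu.mul (isUnit_binomialSeries_padicInt (c + b))) Lf

end Literature.NumberTheory.EllipticCurves.Sprung2017

end
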